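import Literature.NumberTheory.LFunctions.DirichletLDerivativeExplicitBound
import HarnessLib

/-!
# `‖L'(σ, χ)‖ ≤ (log q)²` on `[1 − 1/(40 log q), 1]` for primitive `χ` mod `q ≥ 232`, and
# `‖L(1, χ)‖ ≤ (1 − β)(log q)²` at a real zero `β` there

Topic `Literature/NumberTheory/LFunctions` (continuing `DirichletLDerivativeExplicitBound.lean`).
Everything in this file is PROVED (theorems only; no definition, no named fact).

The structured bound `‖L'(σ, χ)‖ ≤ N^{r}(½ log²N + c log N + c + (c + log N)/(1 − r) + 1/(1 − r)²)`
(`N = ⌈√q(1 + log q)⌉`, `c = 1 + log 2`, `σ ∈ [1 − r, 1]`) of `norm_deriv_LFunction_le_near_one` is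
evaluated at `r = 1/(40 log q)`: `log N ≤ ½ log q + log(2 + log q)`, the tangent lines of `log` at `7`
and `14`, `N^{r} ≤ 1.0223`, `1/(1 − r) ≤ 216/215`, `c ≤ 1.6932` give

* `norm_deriv_LFunction_le_log_sq` — **`‖L'(σ, χ)‖ ≤ (log q)²` for `q ≥ 232`**, `σ ∈ [1 − 1/(40 log q), 1]`,
  `χ` primitive of any order; `norm_deriv_LFunction_le_log_sq_of_ge_1e6` — `≤ 0.46 (log q)²` for
  `q ≥ 10⁶`;
* `norm_LFunction_one_sub_le_of_norm_deriv_le` — the mean value step on `[β, 1]`, and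
  `norm_LFunction_one_le_log_sq_of_realZero` — **at a real zero `β ≥ 1 − 1/(40 log q)` of a primitive
  `χ` mod `q ≥ 232`: `‖L(1, χ)‖ ≤ (1 − β)(log q)²`** — the explicit upper half of Montgomery–Vaughan's
  (11.10) with constant `1` (the tree's `RealZeroRepulsion.norm_LFunction_one_le_mul_log_sq` has `55`,
  `MontgomeryVaughan2007_thm11_4_LOne_exceptional_holds` an inexplicit `C₂`).

Consumed by `RealZeroEffectiveRepulsionExplicitII.lean` (repulsion `1 − β ≥ 2/(3√q log²q)`).
LABEL: instrument (kernel-certified explicit constants). WHAT THIS IS NOT: the asymptotically correct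
constant is `⅛ + o(1)`; `1` and `0.46` are what the uniform ranges `q ≥ 232`, `q ≥ 10⁶` allow here.

## References

* H. L. Montgomery, R. C. Vaughan, *Multiplicative Number Theory I*, CUP 2007, §11.2 Theorem 11.4
  (11.10), Corollary 11.15 (proof), §11.2.1 Exercise 3 (b), §9.4 Thm 9.18. [MontgomeryVaughan2007]
-/

noncomputable section

open Complex Filter Topology Finset Set

namespace Literature.NumberTheory.LFunctions.DirichletAbel

variable {q : ℕ} [NeZero q] (χ : DirichletCharacter ℂ q)

/-! ### The mean value step -/

/-- **Mean value on `[β, 1]`**: if `χ ≠ χ₀` and `‖L'(σ, χ)‖ ≤ M` for all real `σ ∈ [β, 1]`, then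
`‖L(1, χ) − L(β, χ)‖ ≤ M (1 − β)`. [cite: MontgomeryVaughan2007, §11.2 Corollary 11.15 (proof)] -/
theorem norm_LFunction_one_sub_le_of_norm_deriv_le (hχ : χ ≠ 1) {β M : ℝ} (hβ1 : β ≤ 1)
    (hM : ∀ σ : ℝ, β ≤ σ → σ ≤ 1 → ‖deriv χ.LFunction σ‖ ≤ M) :
    ‖χ.LFunction 1 - χ.LFunction β‖ ≤ M * (1 - β) := by
  have hdiff := DirichletCharacter.differentiable_LFunction hχ
  have hseg : ∀ z ∈ segment ℝ (β : ℂ) (1 : ℂ), ∃ σ' : ℝ, β ≤ σ' ∧ σ' ≤ 1 ∧ z = σ' := by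
    intro z hz
    obtain ⟨a, b, ha, hb, hab, rfl⟩ := hz
    refine ⟨a * β + b, by nlinarith, by nlinarith, ?_⟩
    simp only [Complex.real_smul]; push_cast; ring
  have hMV : ‖χ.LFunction 1 - χ.LFunction β‖ ≤ M * ‖(1 : ℂ) - β‖ := by
    refine Convex.norm_image_sub_le_of_norm_deriv_le (s := segment ℝ (β : ℂ) (1 : ℂ))
      (fun z _ ↦ hdiff.differentiableAt) (fun z hz ↦ ?_) (convex_segment _ _)
      (left_mem_segment _ _ _) (right_mem_segment _ _ _)
    obtain ⟨σ', h1, h2, rfl⟩ := hseg z hz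
    exact hM σ' h1 h2
  rwa [show (1 : ℂ) - β = ((1 - β : ℝ) : ℂ) by push_cast; ring, Complex.norm_real,
    Real.norm_of_nonneg (by linarith)] at hMV

/-- **At a real zero near `1`**: for `χ` primitive mod `q ≥ 2`, `r < 1` and a real zero `β`
of `L(s, χ)` with `β ≥ 1 − r`:
`‖L(1, χ)‖ ≤ (1 − β) · N^{r}(½ log²N + c log N + c + (c + log N)/(1−r) + 1/(1−r)²)`,
`N = ⌈√q(1 + log q)⌉`, `c = 1 + log 2` (`0 ≤ r` is not needed). The Pólya–Vinogradov-strength form of the tree's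
`Siegel.norm_LFunction_one_le_of_realZero`. [cite: MontgomeryVaughan2007, §11.2 Corollary 11.15 (proof) and §11.2.1 Exercise 3 (b)] -/
theorem norm_LFunction_one_le_of_realZero_near_one (hq : 2 ≤ q) (hχ : χ.IsPrimitive) {r : ℝ}
    (hr1 : r < 1) {β : ℝ} (hβr : 1 - r ≤ β) (hzero : χ.LFunction β = 0) :
    ‖χ.LFunction 1‖ ≤ (1 - β) *
      ((⌈Real.sqrt q * (1 + Real.log q)⌉₊ : ℝ) ^ r *
        (Real.log ⌈Real.sqrt q * (1 + Real.log q)⌉₊ ^ 2 / 2 +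
          (1 + Real.log 2) * Real.log ⌈Real.sqrt q * (1 + Real.log q)⌉₊ + (1 + Real.log 2) +
          ((1 + Real.log 2) + Real.log ⌈Real.sqrt q * (1 + Real.log q)⌉₊) / (1 - r) +
          1 / (1 - r) ^ 2)) := by
  have hne : χ ≠ 1 := by
    rintro rfl
    rw [DirichletCharacter.isPrimitive_def, DirichletCharacter.conductor_one] at hχ
    omega
  have hβ1 : β < 1 := by
    by_contra hcon
    exact DirichletCharacter.LFunction_ne_zero_of_one_le_re χ (Or.inl hne) (s := β)
      (by simp; linarith) hzero
  have h := norm_LFunction_one_sub_le_of_norm_deriv_le χ hne hβ1.le fun σ h1 h2 =>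
    norm_deriv_LFunction_le_near_one χ hq hχ hr1 (le_trans hβr h1) h2
  rw [hzero, sub_zero] at h
  linarith

/-! ### Numerical lemmas -/

/-- `log q ≥ 27/5` for `q ≥ 232` (`e^{27/5} = e⁵ (e^{1/5})² < 2.7182818286⁵ · (5/4)² < 232`). [folklore] -/
private theorem log_ge_of_ge_232 {q : ℕ} (hq : 232 ≤ q) : (27 : ℝ) / 5 ≤ Real.log q := by
  have hq' : (232 : ℝ) ≤ q := by exact_mod_cast hq
  rw [Real.le_log_iff_exp_le (by linarith)]
  have h1 : Real.exp (27 / 5) = Real.exp 1 ^ 5 * Real.exp (1 / 5) ^ 2 := by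
    rw [← Real.exp_nat_mul, ← Real.exp_nat_mul, ← Real.exp_add]; norm_num
  have he := Real.exp_one_lt_d9
  have h5 : Real.exp 1 ^ 5 ≤ 2.7182818286 ^ 5 :=
    pow_le_pow_left₀ (Real.exp_pos 1).le he.le 5
  have h02 : Real.exp (1 / 5) ≤ 5 / 4 := by
    have := Real.exp_bound_div_one_sub_of_interval' (x := (1 / 5 : ℝ)) (by norm_num) (by norm_num)
    have e : (1 : ℝ) / (1 - 1 / 5) = 5 / 4 := by norm_num
    linarith
  have h02sq : Real.exp (1 / 5) ^ 2 ≤ (5 / 4) ^ 2 := pow_le_pow_left₀ (Real.exp_pos _).le h02 2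
  rw [h1]
  calc Real.exp 1 ^ 5 * Real.exp (1 / 5) ^ 2 ≤ 2.7182818286 ^ 5 * (5 / 4) ^ 2 :=
        mul_le_mul h5 h02sq (by positivity) (by positivity)
    _ ≤ 232 := by norm_num
    _ ≤ q := hq'

/-- `log q ≥ 61/5` for `q ≥ 10⁶` (`e^{61/5} = e¹² e^{1/5} < 2.7182818286¹² · 5/4 < 10⁶`). [folklore] -/
private theorem log_ge_of_ge_1e6 {q : ℕ} (hq : 10 ^ 6 ≤ q) : (61 : ℝ) / 5 ≤ Real.log q := by
  have hq' : (10 : ℝ) ^ 6 ≤ q := by exact_mod_cast hq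
  rw [Real.le_log_iff_exp_le (by linarith)]
  have h1 : Real.exp (61 / 5) = Real.exp 1 ^ 12 * Real.exp (1 / 5) := by
    rw [← Real.exp_nat_mul, ← Real.exp_add]; norm_num
  have he := Real.exp_one_lt_d9
  have h12 : Real.exp 1 ^ 12 ≤ 2.7182818286 ^ 12 :=
    pow_le_pow_left₀ (Real.exp_pos 1).le he.le 12
  have h02 : Real.exp (1 / 5) ≤ 5 / 4 := by
    have := Real.exp_bound_div_one_sub_of_interval' (x := (1 / 5 : ℝ)) (by norm_num) (by norm_num)
    have e : (1 : ℝ) / (1 - 1 / 5) = 5 / 4 := by norm_num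
    linarith
  rw [h1]
  calc Real.exp 1 ^ 12 * Real.exp (1 / 5) ≤ 2.7182818286 ^ 12 * (5 / 4) :=
        mul_le_mul h12 h02 (by positivity) (by positivity)
    _ ≤ (10 : ℝ) ^ 6 := by norm_num
    _ ≤ q := hq'

/-- `log 7 < 39/20` (`7 · e^{1/20} < 7 · 20/19 < 2.7182818283² < e² = e^{39/20} e^{1/20}`). [folklore] -/
private theorem log_seven_lt : Real.log 7 < 39 / 20 := by
  rw [Real.log_lt_iff_lt_exp (by norm_num)]
  have he := Real.exp_one_gt_d9
  have h2 : Real.exp (39 / 20) * Real.exp (1 / 20) = Real.exp 1 ^ 2 := by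
    rw [← Real.exp_add, ← Real.exp_nat_mul]; norm_num
  have h05 : Real.exp (1 / 20) < 20 / 19 := by
    have := Real.exp_bound_div_one_sub_of_interval' (x := (1 / 20 : ℝ)) (by norm_num) (by norm_num)
    have e : (1 : ℝ) / (1 - 1 / 20) = 20 / 19 := by norm_num
    linarith
  have hsq : (2.7182818283 : ℝ) ^ 2 < Real.exp 1 ^ 2 := pow_lt_pow_left₀ he (by norm_num) two_ne_zero
  by_contra hcon
  push Not at hcon
  have hpos := Real.exp_pos (1 / 20 : ℝ)
  have : Real.exp (39 / 20) * Real.exp (1 / 20) ≤ 7 * (20 / 19) := by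
    calc Real.exp (39 / 20) * Real.exp (1 / 20) ≤ 7 * Real.exp (1 / 20) :=
          mul_le_mul_of_nonneg_right hcon hpos.le
      _ ≤ 7 * (20 / 19) := by linarith
  nlinarith

/-- `log 14 < 133/50` (`14 < (2.7182818283 · (1 + 0.33 + 0.33²/2))² ≤ (e · e^{33/100})² = e^{133/50}`).
[folklore] -/
private theorem log_fourteen_lt : Real.log 14 < 133 / 50 := by
  rw [Real.log_lt_iff_lt_exp (by norm_num)]
  have he := Real.exp_one_gt_d9
  have h2 : Real.exp (133 / 50) = (Real.exp 1 * Real.exp (33 / 100)) ^ 2 := by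
    rw [← Real.exp_add, ← Real.exp_nat_mul]; norm_num
  have hq : (1 : ℝ) + 33 / 100 + (33 / 100) ^ 2 / 2 ≤ Real.exp (33 / 100) :=
    Real.quadratic_le_exp_of_nonneg (by norm_num)
  have hprod : (2.7182818283 : ℝ) * (1 + 33 / 100 + (33 / 100) ^ 2 / 2) ≤
      Real.exp 1 * Real.exp (33 / 100) :=
    mul_le_mul he.le hq (by norm_num) (Real.exp_pos 1).le
  rw [h2]
  calc (14 : ℝ) < ((2.7182818283 : ℝ) * (1 + 33 / 100 + (33 / 100) ^ 2 / 2)) ^ 2 := by norm_num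
    _ ≤ (Real.exp 1 * Real.exp (33 / 100)) ^ 2 := pow_le_pow_left₀ (by norm_num) hprod 2

/-- The Pólya–Vinogradov level `N = ⌈√q (1 + log q)⌉` has `log N ≤ ½ log q + log(2 + log q)`
(`q ≥ 2`; `N ≤ √q(1 + log q) + 1 ≤ √q(2 + log q)`). [folklore] -/
private theorem log_level_le {q : ℕ} (hq : 2 ≤ q) :
    Real.log (⌈Real.sqrt q * (1 + Real.log q)⌉₊ : ℝ) ≤ Real.log q / 2 + Real.log (2 + Real.log q) := by
  have hq1 : (1 : ℝ) < q := by exact_mod_cast hq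
  have hq0 : (0 : ℝ) < q := by linarith
  have hlog : 0 < Real.log q := Real.log_pos hq1
  have hs1 : 1 ≤ Real.sqrt q := by
    rw [show (1 : ℝ) = Real.sqrt 1 by simp]; exact Real.sqrt_le_sqrt hq1.le
  have hB0 : 0 < Real.sqrt q * (1 + Real.log q) := by positivity
  have hN : (⌈Real.sqrt q * (1 + Real.log q)⌉₊ : ℝ) ≤ Real.sqrt q * (2 + Real.log q) := by
    have h := (Nat.ceil_lt_add_one hB0.le).le
    nlinarith
  have hNpos : (0 : ℝ) < (⌈Real.sqrt q * (1 + Real.log q)⌉₊ : ℝ) := by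
    exact_mod_cast Nat.ceil_pos.2 hB0
  calc Real.log (⌈Real.sqrt q * (1 + Real.log q)⌉₊ : ℝ)
      ≤ Real.log (Real.sqrt q * (2 + Real.log q)) := Real.log_le_log hNpos hN
    _ = Real.log (Real.sqrt q) + Real.log (2 + Real.log q) :=
        Real.log_mul (by positivity) (by positivity)
    _ = Real.log q / 2 + Real.log (2 + Real.log q) := by rw [Real.log_sqrt hq0.le]

/-- For `log q ≥ 27/5`: `log N ≤ (9/14) log q + 173/140` (tangent of `log` at `7`: `log(2 + L) ≤
log 7 − 1 + (2 + L)/7 < 19/20 + (2 + L)/7`). [folklore] -/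
private theorem log_level_le_lin {q : ℕ} (hq : 2 ≤ q) (hL : 27 / 5 ≤ Real.log q) :
    Real.log (⌈Real.sqrt q * (1 + Real.log q)⌉₊ : ℝ) ≤ 9 / 14 * Real.log q + 173 / 140 := by
  have h := log_level_le hq
  have hpos : 0 < (2 + Real.log q) / 7 := by positivity
  have ht := Real.log_le_sub_one_of_pos hpos
  rw [Real.log_div (by linarith) (by norm_num)] at ht
  have h7 := log_seven_lt
  linarith

/-- For `log q ≥ 61/5`: `log N ≤ (4/7) log q + 631/350` (tangent of `log` at `14`:
`log(2 + L) ≤ log 14 − 1 + (2 + L)/14 < 83/50 + (2 + L)/14`). [folklore] -/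
private theorem log_level_le_lin' {q : ℕ} (hq : 2 ≤ q) (hL : 61 / 5 ≤ Real.log q) :
    Real.log (⌈Real.sqrt q * (1 + Real.log q)⌉₊ : ℝ) ≤ 4 / 7 * Real.log q + 631 / 350 := by
  have h := log_level_le hq
  have hpos : 0 < (2 + Real.log q) / 14 := by positivity
  have ht := Real.log_le_sub_one_of_pos hpos
  rw [Real.log_div (by linarith) (by norm_num)] at ht
  have h14 := log_fourteen_lt
  linarith

/-- **The near-one constant, numerically**: for `log q ≥ 27/5`, `r = 1/(40 log q)`, `N` the
Pólya–Vinogradov level and `ℓ = log N`: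
`N^{r}(ℓ²/2 + cℓ + c + (c + ℓ)/(1 − r) + 1/(1 − r)²) ≤ 1.0223 (ℓ²/2 + 2.7 ℓ + 4.41)`
(`rℓ ≤ 0.02181`, `N^{r} ≤ 1 + rℓ + (rℓ)² ≤ 1.0223`; `r ≤ 1/216`; `c = 1 + log 2 ≤ 1.6932`). [folklore] -/
private theorem nearOne_const_le {q : ℕ} (hq : 2 ≤ q) (hL : 27 / 5 ≤ Real.log q) :
    (⌈Real.sqrt q * (1 + Real.log q)⌉₊ : ℝ) ^ (1 / (40 * Real.log q)) *
        (Real.log ⌈Real.sqrt q * (1 + Real.log q)⌉₊ ^ 2 / 2 +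
          (1 + Real.log 2) * Real.log ⌈Real.sqrt q * (1 + Real.log q)⌉₊ + (1 + Real.log 2) +
          ((1 + Real.log 2) + Real.log ⌈Real.sqrt q * (1 + Real.log q)⌉₊) /
            (1 - 1 / (40 * Real.log q)) +
          1 / (1 - 1 / (40 * Real.log q)) ^ 2) ≤
      10223 / 10000 * (Real.log ⌈Real.sqrt q * (1 + Real.log q)⌉₊ ^ 2 / 2 +
        27 / 10 * Real.log ⌈Real.sqrt q * (1 + Real.log q)⌉₊ + 441 / 100) := by
  set N : ℝ := (⌈Real.sqrt q * (1 + Real.log q)⌉₊ : ℝ) with hNdef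
  set L : ℝ := Real.log q with hLdef
  set ℓ : ℝ := Real.log N with hℓ
  set r : ℝ := 1 / (40 * L) with hr
  set c : ℝ := 1 + Real.log 2 with hc
  have hq1 : (1 : ℝ) < q := by exact_mod_cast hq
  have hL0 : 0 < L := by linarith
  have hB0 : 0 < Real.sqrt q * (1 + Real.log q) :=
    mul_pos (Real.sqrt_pos.2 (by linarith)) (by rw [← hLdef]; linarith)
  have hN1 : (1 : ℝ) ≤ N := by rw [hNdef]; exact_mod_cast Nat.ceil_pos.2 hB0
  have hN0 : 0 < N := by linarith
  have hℓ0 : 0 ≤ ℓ := Real.log_nonneg hN1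
  have hℓle : ℓ ≤ 9 / 14 * L + 173 / 140 := log_level_le_lin hq hL
  have hc2 : c ≤ 1.6932 := by have := Real.log_two_lt_d9; rw [hc]; linarith
  have hc0 : 0 ≤ c := by have := Real.log_nonneg (show (1:ℝ) ≤ 2 by norm_num); rw [hc]; linarith
  -- `r ≤ 1/216`, `1/(1-r) ≤ 216/215`
  have hr0 : 0 < r := by positivity
  have hr216 : r ≤ 1 / 216 := by
    rw [hr]; exact one_div_le_one_div_of_le (by norm_num) (by linarith)
  have h1r : 0 < 1 - r := by linarith
  have hinv : 1 / (1 - r) ≤ 216 / 215 := by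
    rw [div_le_div_iff₀ h1r (by norm_num)]; linarith
  have hinv2 : 1 / (1 - r) ^ 2 ≤ (216 / 215) ^ 2 := by
    rw [← one_div_pow]
    exact pow_le_pow_left₀ (by positivity) hinv 2
  -- `N^r ≤ 1.0223`
  have hx : ℓ * r ≤ 0.02181 := by
    rw [hr, mul_one_div, div_le_iff₀ (by positivity)]
    nlinarith
  have hx0 : 0 ≤ ℓ * r := mul_nonneg hℓ0 hr0.le
  have hNr : N ^ r ≤ 1.0223 := by
    rw [Real.rpow_def_of_pos hN0, ← hℓ]
    have habs : |ℓ * r| ≤ 1 := by rw [abs_of_nonneg hx0]; linarith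
    have h := Real.abs_exp_sub_one_sub_id_le habs
    have h' : Real.exp (ℓ * r) ≤ 1 + ℓ * r + (ℓ * r) ^ 2 := by
      have := (abs_le.mp h).2; linarith
    nlinarith
  -- the bracket
  have hdiv : (c + ℓ) / (1 - r) ≤ (c + ℓ) * (216 / 215) := by
    rw [div_eq_mul_one_div]; exact mul_le_mul_of_nonneg_left hinv (by positivity)
  have hbr : ℓ ^ 2 / 2 + c * ℓ + c + (c + ℓ) / (1 - r) + 1 / (1 - r) ^ 2 ≤
      ℓ ^ 2 / 2 + 27 / 10 * ℓ + 441 / 100 := by nlinarith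
  have hbr0 : 0 ≤ ℓ ^ 2 / 2 + c * ℓ + c + (c + ℓ) / (1 - r) + 1 / (1 - r) ^ 2 := by positivity
  calc N ^ r * (ℓ ^ 2 / 2 + c * ℓ + c + (c + ℓ) / (1 - r) + 1 / (1 - r) ^ 2)
      ≤ 1.0223 * (ℓ ^ 2 / 2 + 27 / 10 * ℓ + 441 / 100) :=
        mul_le_mul hNr hbr hbr0 (by norm_num)
    _ = 10223 / 10000 * (ℓ ^ 2 / 2 + 27 / 10 * ℓ + 441 / 100) := by norm_num

/-! ### The derivative bound in `log² q` units -/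

/-- **`‖L'(σ, χ)‖ ≤ (log q)²` on `[1 − 1/(40 log q), 1]` for every primitive `χ` mod `q ≥ 232`**
(`1.0223(u²/2 + 2.7u + 4.41) ≤ L²` for `u = (9/14)L + 173/140`, `L ≥ 27/5`).
[cite: MontgomeryVaughan2007, §11.2.1 Exercise 3 (b) and §9.4 Thm 9.18] -/
theorem norm_deriv_LFunction_le_log_sq {q : ℕ} [NeZero q] (hq : 232 ≤ q)
    {χ : DirichletCharacter ℂ q} (hχ : χ.IsPrimitive) {σ : ℝ}
    (hσ : 1 - 1 / (40 * Real.log q) ≤ σ) (hσ1 : σ ≤ 1) :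
    ‖deriv χ.LFunction σ‖ ≤ Real.log q ^ 2 := by
  have hq2 : 2 ≤ q := by omega
  have hL := log_ge_of_ge_232 hq
  have hL0 : 0 < Real.log q := by linarith
  have hr1 : 1 / (40 * Real.log q) < 1 := by
    rw [div_lt_one (by positivity)]; linarith
  have h := norm_deriv_LFunction_le_near_one χ hq2 hχ hr1 hσ hσ1
  refine h.trans ((nearOne_const_le hq2 hL).trans ?_)
  have hℓ := log_level_le_lin hq2 hL
  have hℓ0 : 0 ≤ Real.log (⌈Real.sqrt q * (1 + Real.log q)⌉₊ : ℝ) := by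
    have hB0 : 0 < Real.sqrt q * (1 + Real.log q) :=
      mul_pos (Real.sqrt_pos.2 (by exact_mod_cast (show 0 < q by omega))) (by linarith)
    exact Real.log_nonneg (by exact_mod_cast Nat.ceil_pos.2 hB0)
  set ℓ := Real.log (⌈Real.sqrt q * (1 + Real.log q)⌉₊ : ℝ)
  set L := Real.log q
  nlinarith [mul_nonneg (sub_nonneg.2 hL) (sub_nonneg.2 hL), mul_nonneg hℓ0 (sub_nonneg.2 hℓ)]

/-- **`‖L'(σ, χ)‖ ≤ 0.46 (log q)²` on `[1 − 1/(40 log q), 1]` for every primitive `χ` mod `q ≥ 10⁶`**.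
[cite: MontgomeryVaughan2007, §11.2.1 Exercise 3 (b) and §9.4 Thm 9.18] -/
theorem norm_deriv_LFunction_le_log_sq_of_ge_1e6 {q : ℕ} [NeZero q] (hq : 10 ^ 6 ≤ q)
    {χ : DirichletCharacter ℂ q} (hχ : χ.IsPrimitive) {σ : ℝ}
    (hσ : 1 - 1 / (40 * Real.log q) ≤ σ) (hσ1 : σ ≤ 1) :
    ‖deriv χ.LFunction σ‖ ≤ 23 / 50 * Real.log q ^ 2 := by
  have hq2 : 2 ≤ q := le_trans (by norm_num) hq
  have hL := log_ge_of_ge_1e6 hq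
  have hL' : (27 : ℝ) / 5 ≤ Real.log q := by linarith
  have hL0 : 0 < Real.log q := by linarith
  have hr1 : 1 / (40 * Real.log q) < 1 := by
    rw [div_lt_one (by positivity)]; linarith
  have h := norm_deriv_LFunction_le_near_one χ hq2 hχ hr1 hσ hσ1
  refine h.trans ((nearOne_const_le hq2 hL').trans ?_)
  have hℓ := log_level_le_lin' hq2 hL
  have hℓ0 : 0 ≤ Real.log (⌈Real.sqrt q * (1 + Real.log q)⌉₊ : ℝ) := by
    have hB0 : 0 < Real.sqrt q * (1 + Real.log q) :=
      mul_pos (Real.sqrt_pos.2 (by exact_mod_cast (show 0 < q by omega))) (by linarith)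
    exact Real.log_nonneg (by exact_mod_cast Nat.ceil_pos.2 hB0)
  set ℓ := Real.log (⌈Real.sqrt q * (1 + Real.log q)⌉₊ : ℝ)
  set L := Real.log q
  nlinarith [mul_nonneg (sub_nonneg.2 hL) (sub_nonneg.2 hL), mul_nonneg hℓ0 (sub_nonneg.2 hℓ)]

/-- **Explicit (11.10), upper half, v2**: for a PRIMITIVE `χ` mod `q ≥ 232` (any order) and a real
zero `β ≥ 1 − 1/(40 log q)`: `‖L(1, χ)‖ ≤ (1 − β)(log q)²` — the constant `55` of
`norm_LFunction_one_le_mul_log_sq` becomes `1`. [cite: MontgomeryVaughan2007, Theorem 11.4 (11.10) and §11.2.1 Exercise 3 (b)] -/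
theorem norm_LFunction_one_le_log_sq_of_realZero {q : ℕ} [NeZero q] (hq : 232 ≤ q)
    {χ : DirichletCharacter ℂ q} (hχ : χ.IsPrimitive) {β : ℝ}
    (hβ : 1 - 1 / (40 * Real.log q) ≤ β) (hzero : χ.LFunction β = 0) :
    ‖χ.LFunction 1‖ ≤ (1 - β) * Real.log q ^ 2 := by
  have hne : χ ≠ 1 := by
    rintro rfl
    rw [DirichletCharacter.isPrimitive_def, DirichletCharacter.conductor_one] at hχ
    omega
  have hβ1 : β < 1 := by
    by_contra hcon
    exact DirichletCharacter.LFunction_ne_zero_of_one_le_re χ (Or.inl hne) (s := β)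
      (by simp; linarith) hzero
  have h := norm_LFunction_one_sub_le_of_norm_deriv_le χ hne hβ1.le fun σ h1 h2 =>
    norm_deriv_LFunction_le_log_sq hq hχ (le_trans hβ h1) h2
  rw [hzero, sub_zero] at h
  linarith

/-! ### The wider window `[1 − 1/(10 log q), 1]` — Benli–Goel–Twiss–Zaman's Landau–Siegel window

[BenliGoelTwissZaman2025] (Hypothesis 2.6, Lemma 2.9) place the putative real zero at
`β₁ > 1 − 1/(10 log q)` with `q > 4·10⁵` (Platt's range); Lemma 2.9 there asserts
`L(1,χ₁)/(1 − β₁) ≤ 0.18 log² q`, citing Bordignon 2019 (whose `L′`-bounds are for PRIMITIVE characters and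
rest on Frolenkov–Soundararajan's Pólya–Vinogradov constant). The structured bound of
`norm_deriv_LFunction_le_near_one` evaluated at `r = 1/(10 log q)` with the tree's own Pólya–Vinogradov
constant gives the same shape with the constant `½`, uniformly from `q = 4·10⁵` on, for every primitive
`χ` (any order). -/

/-- `log q ≥ 64/5` for `q ≥ 4·10⁵` (`e^{64/5} · e^{1/5} = e¹³ ≤ 2.7182818286¹³ < 4·10⁵ · 6/5` and
`e^{1/5} ≥ 6/5`). [folklore] -/
private theorem log_ge_of_ge_4e5 {q : ℕ} (hq : 400000 ≤ q) : (64 : ℝ) / 5 ≤ Real.log q := by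
  have hq' : (400000 : ℝ) ≤ q := by exact_mod_cast hq
  rw [Real.le_log_iff_exp_le (by linarith)]
  have h1 : Real.exp (64 / 5) * Real.exp (1 / 5) = Real.exp 1 ^ 13 := by
    rw [← Real.exp_add, ← Real.exp_nat_mul]; norm_num
  have he := Real.exp_one_lt_d9
  have h13 : Real.exp 1 ^ 13 ≤ 2.7182818286 ^ 13 :=
    pow_le_pow_left₀ (Real.exp_pos 1).le he.le 13
  have h15 : (6 : ℝ) / 5 ≤ Real.exp (1 / 5) := by
    have := Real.add_one_le_exp (1 / 5 : ℝ); linarith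
  have hpos := Real.exp_pos (64 / 5 : ℝ)
  have hprod : Real.exp (64 / 5) * (6 / 5) ≤ 2.7182818286 ^ 13 :=
    le_trans (mul_le_mul_of_nonneg_left h15 hpos.le) (h1 ▸ h13)
  have hnum : (2.7182818286 : ℝ) ^ 13 ≤ 400000 * (6 / 5) := by norm_num
  nlinarith

/-- **The constant on the wider window, numerically**: for `log q ≥ 64/5`, `r = 1/(10 log q)`, `N` the
Pólya–Vinogradov level and `ℓ = log N`:
`N^{r}(ℓ²/2 + cℓ + c + (c + ℓ)/(1 − r) + 1/(1 − r)²) ≤ 1.0764 (ℓ²/2 + 2.702 ℓ + 4.42)`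
(`ℓ ≤ (4/7) log q + 631/350`, so `rℓ ≤ 0.0713` and `N^{r} ≤ 1 + rℓ + (rℓ)² ≤ 1.0764`; `r ≤ 1/128`;
`c = 1 + log 2 ≤ 1.6932`). [folklore] -/
private theorem nearOne_const_le_tenth {q : ℕ} (hq : 2 ≤ q) (hL : 64 / 5 ≤ Real.log q) :
    (⌈Real.sqrt q * (1 + Real.log q)⌉₊ : ℝ) ^ (1 / (10 * Real.log q)) *
        (Real.log ⌈Real.sqrt q * (1 + Real.log q)⌉₊ ^ 2 / 2 +
          (1 + Real.log 2) * Real.log ⌈Real.sqrt q * (1 + Real.log q)⌉₊ + (1 + Real.log 2) +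
          ((1 + Real.log 2) + Real.log ⌈Real.sqrt q * (1 + Real.log q)⌉₊) /
            (1 - 1 / (10 * Real.log q)) +
          1 / (1 - 1 / (10 * Real.log q)) ^ 2) ≤
      10764 / 10000 * (Real.log ⌈Real.sqrt q * (1 + Real.log q)⌉₊ ^ 2 / 2 +
        2702 / 1000 * Real.log ⌈Real.sqrt q * (1 + Real.log q)⌉₊ + 442 / 100) := by
  set N : ℝ := (⌈Real.sqrt q * (1 + Real.log q)⌉₊ : ℝ) with hNdef
  set L : ℝ := Real.log q with hLdef
  set ℓ : ℝ := Real.log N with hℓ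
  set r : ℝ := 1 / (10 * L) with hr
  set c : ℝ := 1 + Real.log 2 with hc
  have hq1 : (1 : ℝ) < q := by exact_mod_cast hq
  have hL0 : 0 < L := by linarith
  have hB0 : 0 < Real.sqrt q * (1 + Real.log q) :=
    mul_pos (Real.sqrt_pos.2 (by linarith)) (by rw [← hLdef]; linarith)
  have hN1 : (1 : ℝ) ≤ N := by rw [hNdef]; exact_mod_cast Nat.ceil_pos.2 hB0
  have hN0 : 0 < N := by linarith
  have hℓ0 : 0 ≤ ℓ := Real.log_nonneg hN1
  have hℓle : ℓ ≤ 4 / 7 * L + 631 / 350 := log_level_le_lin' hq (by linarith)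
  have hc2 : c ≤ 1.6932 := by have := Real.log_two_lt_d9; rw [hc]; linarith
  have hc0 : 0 ≤ c := by have := Real.log_nonneg (show (1:ℝ) ≤ 2 by norm_num); rw [hc]; linarith
  -- `r ≤ 1/128`, `1/(1-r) ≤ 128/127`
  have hr0 : 0 < r := by positivity
  have hr128 : r ≤ 1 / 128 := by
    rw [hr]; exact one_div_le_one_div_of_le (by norm_num) (by linarith)
  have h1r : 0 < 1 - r := by linarith
  have hinv : 1 / (1 - r) ≤ 128 / 127 := by
    rw [div_le_div_iff₀ h1r (by norm_num)]; linarith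
  have hinv2 : 1 / (1 - r) ^ 2 ≤ (128 / 127) ^ 2 := by
    rw [← one_div_pow]
    exact pow_le_pow_left₀ (by positivity) hinv 2
  -- `N^r ≤ 1.0764`
  have hx : ℓ * r ≤ 0.0713 := by
    rw [hr, mul_one_div, div_le_iff₀ (by positivity)]
    nlinarith
  have hx0 : 0 ≤ ℓ * r := mul_nonneg hℓ0 hr0.le
  have hNr : N ^ r ≤ 1.0764 := by
    rw [Real.rpow_def_of_pos hN0, ← hℓ]
    have habs : |ℓ * r| ≤ 1 := by rw [abs_of_nonneg hx0]; linarith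
    have h := Real.abs_exp_sub_one_sub_id_le habs
    have h' : Real.exp (ℓ * r) ≤ 1 + ℓ * r + (ℓ * r) ^ 2 := by
      have := (abs_le.mp h).2; linarith
    nlinarith
  -- the bracket
  have hdiv : (c + ℓ) / (1 - r) ≤ (c + ℓ) * (128 / 127) := by
    rw [div_eq_mul_one_div]; exact mul_le_mul_of_nonneg_left hinv (by positivity)
  have hbr : ℓ ^ 2 / 2 + c * ℓ + c + (c + ℓ) / (1 - r) + 1 / (1 - r) ^ 2 ≤
      ℓ ^ 2 / 2 + 2702 / 1000 * ℓ + 442 / 100 := by nlinarith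
  have hbr0 : 0 ≤ ℓ ^ 2 / 2 + c * ℓ + c + (c + ℓ) / (1 - r) + 1 / (1 - r) ^ 2 := by positivity
  calc N ^ r * (ℓ ^ 2 / 2 + c * ℓ + c + (c + ℓ) / (1 - r) + 1 / (1 - r) ^ 2)
      ≤ 1.0764 * (ℓ ^ 2 / 2 + 2702 / 1000 * ℓ + 442 / 100) :=
        mul_le_mul hNr hbr hbr0 (by norm_num)
    _ = 10764 / 10000 * (ℓ ^ 2 / 2 + 2702 / 1000 * ℓ + 442 / 100) := by norm_num

/-- **`‖L'(σ, χ)‖ ≤ ½ (log q)²` on the wider window `[1 − 1/(10 log q), 1]`, for every primitive `χ`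
mod `q ≥ 4·10⁵`** (any order) — the window of Benli–Goel–Twiss–Zaman's Landau–Siegel zero
(Hypothesis 2.6 / Lemma 2.9, `β₁ > 1 − 1/(10 log q)`, `q > 4·10⁵`). The constant `½` is what the tree's
Pólya–Vinogradov constant `√q(1 + log q)` yields uniformly from `q = 4·10⁵` on
(`1.0764(u²/2 + 2.702u + 4.42) ≤ L²/2` for `u = (4/7)L + 631/350`, `L ≥ 64/5`); Bordignon's printed
`0.18` (odd) / `0.1536` (even) rest on Frolenkov–Soundararajan's sharper inequality and on real `χ`.
LABEL: instrument (kernel-certified explicit constant). [cite: MontgomeryVaughan2007, §11.2.1 Exercise 3 (b) and §9.4 Thm 9.18]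
[cite: BenliGoelTwissZaman2025, Hypothesis 2.6 and Lemma 2.9 (the window)] -/
theorem norm_deriv_LFunction_le_half_log_sq_of_ge_4e5 {q : ℕ} [NeZero q] (hq : 400000 ≤ q)
    {χ : DirichletCharacter ℂ q} (hχ : χ.IsPrimitive) {σ : ℝ}
    (hσ : 1 - 1 / (10 * Real.log q) ≤ σ) (hσ1 : σ ≤ 1) :
    ‖deriv χ.LFunction σ‖ ≤ 1 / 2 * Real.log q ^ 2 := by
  have hq2 : 2 ≤ q := le_trans (by norm_num) hq
  have hL := log_ge_of_ge_4e5 hq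
  have hL' : (61 : ℝ) / 5 ≤ Real.log q := by linarith
  have hL0 : 0 < Real.log q := by linarith
  have hr1 : 1 / (10 * Real.log q) < 1 := by
    rw [div_lt_one (by positivity)]; linarith
  have h := norm_deriv_LFunction_le_near_one χ hq2 hχ hr1 hσ hσ1
  refine h.trans ((nearOne_const_le_tenth hq2 hL).trans ?_)
  have hℓ := log_level_le_lin' hq2 hL'
  have hℓ0 : 0 ≤ Real.log (⌈Real.sqrt q * (1 + Real.log q)⌉₊ : ℝ) := by
    have hB0 : 0 < Real.sqrt q * (1 + Real.log q) :=
      mul_pos (Real.sqrt_pos.2 (by exact_mod_cast (show 0 < q by omega))) (by linarith)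
    exact Real.log_nonneg (by exact_mod_cast Nat.ceil_pos.2 hB0)
  set ℓ := Real.log (⌈Real.sqrt q * (1 + Real.log q)⌉₊ : ℝ)
  set L := Real.log q
  nlinarith [mul_nonneg (sub_nonneg.2 hL) (sub_nonneg.2 hL), mul_nonneg hℓ0 (sub_nonneg.2 hℓ)]

/-- **At a real zero `β ≥ 1 − 1/(10 log q)` of a PRIMITIVE `χ` mod `q ≥ 4·10⁵` (any order):
`‖L(1, χ)‖ ≤ ½ (1 − β)(log q)²** — the mean value step on `[β, 1]`
(`norm_LFunction_one_sub_le_of_norm_deriv_le`) with `norm_deriv_LFunction_le_half_log_sq_of_ge_4e5`. This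
is the upper inequality of Benli–Goel–Twiss–Zaman's Lemma 2.9 («`L(1,χ₁)/(1 − β₁) ≤ 0.18 (log q)²`»,
stated there for every real `χ₁` mod `q > 4·10⁵`) in the generality its printed source (Bordignon 2019:
PRIMITIVE `χ`) supports, with the constant the tree's Pólya–Vinogradov inequality yields; the BGTZ-shaped
form is `BGTZ2025.lemma29_upper_primitive` (`ExplicitExceptionalZeroBoundsRealCharacters`).
[cite: MontgomeryVaughan2007, Theorem 11.4 (11.10) and §11.2.1 Exercise 3 (b)]
[cite: BenliGoelTwissZaman2025, Lemma 2.9] -/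
theorem norm_LFunction_one_le_half_log_sq_of_realZero_tenth {q : ℕ} [NeZero q] (hq : 400000 ≤ q)
    {χ : DirichletCharacter ℂ q} (hχ : χ.IsPrimitive) {β : ℝ}
    (hβ : 1 - 1 / (10 * Real.log q) ≤ β) (hzero : χ.LFunction β = 0) :
    ‖χ.LFunction 1‖ ≤ 1 / 2 * Real.log q ^ 2 * (1 - β) := by
  have hne : χ ≠ 1 := by
    rintro rfl
    rw [DirichletCharacter.isPrimitive_def, DirichletCharacter.conductor_one] at hχ
    omega
  have hβ1 : β < 1 := by
    by_contra hcon
    exact DirichletCharacter.LFunction_ne_zero_of_one_le_re χ (Or.inl hne) (s := β)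
      (by simp; linarith) hzero
  have h := norm_LFunction_one_sub_le_of_norm_deriv_le χ hne hβ1.le fun σ h1 h2 =>
    norm_deriv_LFunction_le_half_log_sq_of_ge_4e5 hq hχ (le_trans hβ h1) h2
  rw [hzero, sub_zero] at h
  linarith

end Literature.NumberTheory.LFunctions.DirichletAbel
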